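import Summits.KontsevichZagierPeriods.KontsevichZagierPeriods.Theorems.HurwitzMicroSectorsNormalFormPrincipleLevelOne
import Summits.KontsevichZagierPeriods.KontsevichZagierPeriods.Theorems.HurwitzMicroSectorsNormalFormPrincipleSlabASubPtK20
import Summits.KontsevichZagierPeriods.KontsevichZagierPeriods.Theorems.HurwitzMicroSectorsNormalFormPrincipleAlgCarriers
import Summits.KontsevichZagierPeriods.KontsevichZagierPeriods.Theorems.HurwitzMicroSectorsNormalFormPrincipleM2FiveZetaTwo

/-!
# `NormalFormPrinciple` (stmt-KontsevichZagierPeriods-3869), line `SketchIdeator1` — leaf `stub_boxRigidity`: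
# level one with real-algebraic coefficients: the algebraic rigid numbers and the normal-form bookkeeping

Registered sub-goal `alg_rigid_kit` of the layer "level one with real-algebraic coefficients"
(lead file `…AlgLevelOne`, seat c8). The level-one representations `[(0,1)², P/(1 − xy)]` with
`P ∈ (ℚ̄ ∩ ℝ)[x,y]` reduce to the normal form `[(0,1)², β/(1 − xy)] + [pt, q]` with `β, q` real
algebraic, of value `β·π²/6 + q`. This file is the arithmetic and bookkeeping kit of that normal form:

1. rigidity of the numbers: `β·π²/6 + q = β'·π²/6 + q'` with `β, q, β', q'` real algebraic forces
   `β = β'` and `q = q'` — otherwise `π² = 6(q' − q)/(β − β')` would be algebraic, hence `π` algebraic,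
   contradicting Lindemann (`transcendental_pi_holds`, proved in the tree);
2. the value of the box part `[(0,1)², β/(1 − xy)]` is `β·π²/6` (Beukers' integral
   `box_integral_one_div_one_sub_mul_two`) and of the point part `[pt, r]` is `r`;
3. additivity of the box parts in `β` and of the points in `r` (rule 1b, one generator each);
4. existence of `[(0,1)², β/(1 − xy)]` for real algebraic `β` (constant of algebraic value over the
   `ℚ`-rational Beukers kernel).

References: M. Kontsevich, D. Zagier, *Periods* (2001), §1.1–1.2; F. Lindemann, *Über die Zahl π*,
Math. Ann. 20 (1882); F. Beukers, Bull. LMS 11 (1979). No new definitions.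
-/

noncomputable section

open MeasureTheory Set
open Literature.NumberTheory.Transcendental Literature.NumberTheory.Transcendental.KZ
open Literature.ModelTheory.ExponentialFields (IsSemialgebraic)

namespace Summit.KontsevichZagierPeriods.HurwitzMicroSectors.NormalFormPrinciple.PiBox.AlgLevelOne

/-! ## (1) Rigidity of the numbers `β·π²/6 + q`, `β, q` real algebraic -/

/-- **Rigidity of the algebraic level-one normal form.** If `β·π²/6 + q = β'·π²/6 + q'` with
`β, q, β', q'` real algebraic, then `β = β'` and `q = q'`: if `β ≠ β'` then
`π² = 6(q' − q)/(β − β')` is algebraic over `ℚ` (algebraic numbers form a field), hence so is `π`,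
contradicting the transcendence of `π` (Lindemann 1882, `transcendental_pi_holds`).
[cite: KontsevichZagier2001, §1.2] -/
theorem rigid_numbers {β q β' q' : ℝ} (hβ : IsAlgebraic ℚ β) (hq : IsAlgebraic ℚ q)
    (hβ' : IsAlgebraic ℚ β') (hq' : IsAlgebraic ℚ q')
    (h : β * (Real.pi ^ 2 / 6) + q = β' * (Real.pi ^ 2 / 6) + q') : β = β' ∧ q = q' := by
  have hπ : Transcendental ℚ Real.pi := transcendental_pi_holds
  have h6 : IsAlgebraic ℚ (6 : ℝ) := by exact_mod_cast isAlgebraic_nat (R := ℚ) (A := ℝ) 6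
  have hββ' : β = β' := by
    by_contra hne
    have hd : β - β' ≠ 0 := sub_ne_zero.mpr hne
    have hpi : Real.pi ^ 2 = 6 * (q' - q) * (β - β')⁻¹ := by
      rw [← div_eq_mul_inv, eq_div_iff hd]
      linear_combination 6 * h
    refine hπ (IsAlgebraic.of_pow two_pos ?_)
    rw [hpi]
    exact (h6.mul (hq'.sub hq)).mul (hβ.sub hβ').inv
  subst hββ'
  exact ⟨rfl, add_left_cancel h⟩

/-! ## (2) Values of the normal-form pieces -/

/-- **Value of the box part.** An integral representation of dimension `2` on the open unit box
with integrand `β/(1 − x₀x₁)` (`β ∈ ℝ`) represents `β·π²/6`: pull the constant out of the set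
integral and use Beukers' `∫∫_{(0,1)²} dx₀dx₁/(1 − x₀x₁) = π²/6`. [cite: KontsevichZagier2001, §1.1] -/
theorem value_zetaTwoRep (β : ℝ) (B : IntegralRep 2)
    (hBd : B.domain = {x | ∀ i, x i ∈ Set.Ioo (0:ℝ) 1})
    (hBi : EqOn B.integrand (fun x => β / (1 - x 0 * x 1)) B.domain) :
    B.value = β * (Real.pi ^ 2 / 6) := by
  rw [KZ.IntegralRep.value, setIntegral_congr_fun (KZ.IntegralRep.measurableSet_domain_holds B) hBi,
    hBd]
  simp_rw [div_eq_mul_one_div β]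
  rw [integral_const_mul, box_integral_one_div_one_sub_mul_two.2]

/-- **Value of a point representation**: `[pt, r]` represents `r` (`Dlog.value_pt`).
[cite: KontsevichZagier2001, §1.1] -/
theorem value_pt (r : ℝ) (Z : IntegralRep 0) (hZd : Z.domain = Set.univ)
    (hZi : Z.integrand = fun _ => r) : Z.value = r :=
  Dlog.value_pt Z hZd hZi

/-! ## (3) Additivity of the normal-form pieces -/

/-- **Additivity of the box part in `β`** (rule 1b, one integrand-additivity generator).
[cite: KontsevichZagier2001, §1.2 rule (1)] -/
theorem zetaTwoRep_add_mem_relations (β₁ β₂ : ℝ) (B B₁ B₂ : IntegralRep 2)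
    (hBd : B.domain = {x | ∀ i, x i ∈ Set.Ioo (0:ℝ) 1})
    (hBi : EqOn B.integrand (fun x => (β₁ + β₂) / (1 - x 0 * x 1)) B.domain)
    (hB₁d : B₁.domain = {x | ∀ i, x i ∈ Set.Ioo (0:ℝ) 1})
    (hB₁i : EqOn B₁.integrand (fun x => β₁ / (1 - x 0 * x 1)) B₁.domain)
    (hB₂d : B₂.domain = {x | ∀ i, x i ∈ Set.Ioo (0:ℝ) 1})
    (hB₂i : EqOn B₂.integrand (fun x => β₂ / (1 - x 0 * x 1)) B₂.domain) :
    of B - of B₁ - of B₂ ∈ relations := by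
  refine integrandAddRel_subset_relations ⟨2, B, B₁, B₂, hB₁d.trans hBd.symm, hB₂d.trans hBd.symm,
    fun x hx => ?_, rfl⟩
  have hx₁ : x ∈ B₁.domain := by rw [hB₁d, ← hBd]; exact hx
  have hx₂ : x ∈ B₂.domain := by rw [hB₂d, ← hBd]; exact hx
  rw [Pi.add_apply, hBi hx, hB₁i hx₁, hB₂i hx₂]
  ring

/-- **Additivity of point representations**: `[pt, r + s] − [pt, r] − [pt, s] ∈ relations`
(rule 1b; `Dlog.pt_add_mem_relations`). [cite: KontsevichZagier2001, §1.2 rule (1)] -/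
theorem pt_add_mem_relations (r s : ℝ) (Z Z₁ Z₂ : IntegralRep 0) (hZd : Z.domain = Set.univ)
    (hZi : Z.integrand = fun _ => r + s) (hZ₁d : Z₁.domain = Set.univ)
    (hZ₁i : Z₁.integrand = fun _ => r) (hZ₂d : Z₂.domain = Set.univ)
    (hZ₂i : Z₂.integrand = fun _ => s) : of Z - of Z₁ - of Z₂ ∈ relations :=
  Dlog.pt_add_mem_relations Z Z₁ Z₂ hZd hZ₁d hZ₂d hZi hZ₁i hZ₂i

/-! ## (4) Existence of the box part for an algebraic coefficient -/

/-- **Existence of `[(0,1)², β/(1 − x₀x₁)]` for real algebraic `β`.** The open unit box is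
`ℚ`-semialgebraic, the integrand is the constant `β` (of algebraic value, hence a `ℚ`-semialgebraic
function) over the non-vanishing `ℚ`-polynomial `1 − x₀x₁`, and it is integrable (Beukers' kernel
times a constant). [cite: KontsevichZagier2001, §1.1] -/
theorem exists_zetaTwoRep {β : ℝ} (hβ : IsAlgebraic ℚ β) :
    ∃ B : IntegralRep 2, B.domain = {x | ∀ i, x i ∈ Set.Ioo (0:ℝ) 1} ∧
      B.integrand = fun x => β / (1 - x 0 * x 1) := by
  refine ⟨⟨_, _, isSemialgebraic_box 2, ?_, ?_⟩, rfl, rfl⟩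
  · refine ((isSemialgebraicFunOn_const_of_isAlgebraic (isSemialgebraic_box 2) hβ).div
      (isSemialgebraicFunOn_aeval (isSemialgebraic_box 2)
        (1 - MvPolynomial.X 0 * MvPolynomial.X 1 : MvPolynomial (Fin 2) ℚ)) fun x hx => ?_).congr
      fun x _ => ?_
    · simp only [map_sub, map_one, map_mul, MvPolynomial.aeval_X]
      exact (LevelOne.one_sub_mul_pos_of_mem_box hx).ne'
    · simp only [map_sub, map_one, map_mul, MvPolynomial.aeval_X]
  · have e : (fun x : Fin 2 → ℝ => β / (1 - x 0 * x 1)) = fun x => β * (1 / (1 - x 0 * x 1)) := by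
      funext x
      rw [mul_one_div]
    rw [e]
    exact Integrable.const_mul box_integral_one_div_one_sub_mul_two.1 β

/-! ## The registered kit -/

/-- **Stub A5 (the algebraic rigid numbers and the normal-form bookkeeping).** Six conjuncts:
rigidity of `β·π²/6 + q` for real algebraic `β, q` (transcendence of `π`, Lindemann); the value
`β·π²/6` of the box part `[(0,1)², β/(1 − x₀x₁)]` (Beukers) and the value `r` of `[pt, r]`;
additivity of box parts and of points (rule 1b); existence of the box part for algebraic `β`.
[cite: KontsevichZagier2001, §1.2] -/
theorem alg_rigid_kit :
    (∀ (β q β' q' : ℝ), IsAlgebraic ℚ β → IsAlgebraic ℚ q → IsAlgebraic ℚ β' → IsAlgebraic ℚ q' →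
      β * (Real.pi ^ 2 / 6) + q = β' * (Real.pi ^ 2 / 6) + q' → β = β' ∧ q = q') ∧
    (∀ (β : ℝ) (B : IntegralRep 2), B.domain = {x | ∀ i, x i ∈ Set.Ioo (0:ℝ) 1} →
      EqOn B.integrand (fun x => β / (1 - x 0 * x 1)) B.domain → B.value = β * (Real.pi ^ 2 / 6)) ∧
    (∀ (r : ℝ) (Z : IntegralRep 0), Z.domain = Set.univ → (Z.integrand = fun _ => r) → Z.value = r) ∧
    (∀ (β₁ β₂ : ℝ) (B B₁ B₂ : IntegralRep 2), B.domain = {x | ∀ i, x i ∈ Set.Ioo (0:ℝ) 1} →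
      EqOn B.integrand (fun x => (β₁ + β₂) / (1 - x 0 * x 1)) B.domain →
      B₁.domain = {x | ∀ i, x i ∈ Set.Ioo (0:ℝ) 1} →
      EqOn B₁.integrand (fun x => β₁ / (1 - x 0 * x 1)) B₁.domain →
      B₂.domain = {x | ∀ i, x i ∈ Set.Ioo (0:ℝ) 1} →
      EqOn B₂.integrand (fun x => β₂ / (1 - x 0 * x 1)) B₂.domain →
      of B - of B₁ - of B₂ ∈ relations) ∧
    (∀ (r s : ℝ) (Z Z₁ Z₂ : IntegralRep 0), Z.domain = Set.univ → (Z.integrand = fun _ => r + s) →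
      Z₁.domain = Set.univ → (Z₁.integrand = fun _ => r) → Z₂.domain = Set.univ →
      (Z₂.integrand = fun _ => s) → of Z - of Z₁ - of Z₂ ∈ relations) ∧
    (∀ (β : ℝ), IsAlgebraic ℚ β → ∃ B : IntegralRep 2, B.domain = {x | ∀ i, x i ∈ Set.Ioo (0:ℝ) 1} ∧
      B.integrand = fun x => β / (1 - x 0 * x 1)) :=
  ⟨fun _ _ _ _ hβ hq hβ' hq' h => rigid_numbers hβ hq hβ' hq' h, value_zetaTwoRep, value_pt,
    zetaTwoRep_add_mem_relations, pt_add_mem_relations, fun _ hβ => exists_zetaTwoRep hβ⟩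

end Summit.KontsevichZagierPeriods.HurwitzMicroSectors.NormalFormPrinciple.PiBox.AlgLevelOne
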